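import Mathlib
import HarnessLib
import Summits.NavierStokesRegularity.NavierStokesRegularity.Theorems.TaylorModelRungThreeCertificateReadoutVInterpWinP
import Summits.NavierStokesRegularity.NavierStokesRegularity.Theorems.TaylorModelRungThreeCertificateReadoutVStepWinPSound
import Summits.NavierStokesRegularity.NavierStokesRegularity.Theorems.TaylorModelRungThreeCertificateReadoutVSoundWinB
import Summits.NavierStokesRegularity.NavierStokesRegularity.Theorems.TaylorModelRungThreeVReadoutsWinPDefs

/-!
# Crux K1b-DR (stmt-NavierStokesRegularity-23954), line `taylor-model` — v3 WINDOWED read-outs (POINCARÉ-CORRECTED) SOUNDNESS, part A (ns-tm-g4 g6):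
# bridges from the interpreted records `toCertDataVW / toBoxesW / toRadiiW / toReadoutDataWin / toWinData` to the windowed
# read-out kernel `readoutStepWinP` (`…ReadoutVStepWinP/…StepWinPSound`), and the clauses (R5), (R7), (R8w), (W1), (W2p), (W3p)
# of `ReadoutsVP` (`…VReadoutsWinPDefs`) for the records `toReadoutDataWinP` / `toWinDataP`

Window analogue of typer g32's `…ReadoutVSoundA` (whose generic bridges — `memVec_of_inBox_hull`, `inStep_window`, `mem_covB`,
`rlo_le`, `tail_le`, `mem_AK`, `mem_faceB`, `mem_listB`, `lengths_le_nF`, … — are reused as landed: the windowed input's `base` IS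
part 5's `roIn`).  From `(TV.roOutWinP kitOf wT A WV j).ok = true`:
* `wv_inStep_state` — window values of an in-step state `TP(u) + r + kapp A (y − x)`;
* `readoutWP_Zl_gen` — the in-step state of a hull-`l` start at `u` (inside the level-1 window, `u ∈ U`, `u ≤ uR`) lies in the
  kernel's box `Zl U uR Hl`;
* `readoutWP_R5`, `readoutWP_R7` (fat box), `readoutWP_R8` (on `Z¹`), `readoutWP_W1` (window order),
  `readoutWP_W2` / `readoutWP_W3` (window-end sections, both levels).
Part B: (R6), (R10w), (R11w), (W4) and the assembly `readoutsVW_of_checks'`.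

HONEST FRAMING: kernel bookkeeping for the MODEL certificate №23954 (rung TL-M3); nothing here is a statement about the
Navier–Stokes equations.
-/

-- the sub-problem namespace repeats the summit name by design (D-0017)
set_option linter.dupNamespace false

namespace Summit.NavierStokesRegularity.NavierStokesRegularity.Theorems.TaylorModelCert

open scoped BigOperators
open Set
open Literature.Analysis.FluidPDE.TaoCascade Literature.Analysis.FluidPDE.TaoCascade.TaylorChain
open Summit.NavierStokesRegularity.NavierStokesRegularity.Theorems.TaylorModelReadout
open Summit.NavierStokesRegularity.NavierStokesRegularity.Theorems.TaylorModelV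

namespace CertTablesV

variable {TV : CertTablesV} {kitOf : ℕ → CoreKit} {wT : ℕ → Array Dyad} {sc : ScalarsV} {A : ReadoutAux QS2} {WV : WindowsV}

/-! ### The windowed in-step box of the records -/

/-- **The windowed in-step box, generic**: for `u ∈ U` inside the level-1 window (`u1lo ≤ u ≤ u1hi`), `u ≤ uR`, an in-step kernel
`Ak` at `u`, a hull-`l` start `y` and a remainder `r`, the window values of `TP(u) + r + kapp Ak (y − x)` lie in `Zl U uR Hl`
(`Hl` = the hull box of level `l`). [folklore] -/
theorem readoutWP_Zl_gen (hk : KitOK TV kitOf) {j : ℕ} (hok : (TV.roOutWinP kitOf wT A WV j).ok = true) {l : Fin 3} {Hl : Array IntervalD}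
    (hH : Hl = TV.hullBox kitOf wT j l ((TV.base.stage j).S - 1)) {U : IntervalD} {uR : Dyad}
    {u : ℝ} (huU : IntervalD.mem u U) (hulo : (winAt WV j).u1lo.toReal ≤ u) (huhi : u ≤ (winAt WV j).u1hi.toReal) (huR : u ≤ uR.toReal)
    {Ak : Ker} (hA : InStepKer (TV.toCertDataVW kitOf wT sc) (TV.toBoxesW kitOf wT) j ((TV.toCertDataVW kitOf wT sc).S j - 1) u Ak)
    {y : Fin 4 → ℤ → ℝ} (hy : InBox (TV.toCertDataVW kitOf wT sc) ((TV.toBoxesW kitOf wT).hlo l j ((TV.toCertDataVW kitOf wT sc).S j - 1))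
      ((TV.toBoxesW kitOf wT).hhi l j ((TV.toCertDataVW kitOf wT sc).S j - 1)) y)
    {r : Fin 4 → ℤ → ℝ} (hr : AbsLeW (TV.toCertDataVW kitOf wT sc) r
      (fun i k => (TV.toBoxesW kitOf wT).J j ((TV.toCertDataVW kitOf wT sc).S j - 1) i k * u ^ ((TV.toCertDataVW kitOf wT sc).pdeg + 1))) :
    MemVec TV.base.n (TV.base.wv ((TV.toCertDataVW kitOf wT sc).TP j ((TV.toCertDataVW kitOf wT sc).S j - 1) u + r +
        kapp (TV.toCertDataVW kitOf wT sc) Ak (y - (TV.toCertDataVW kitOf wT sc).x j ((TV.toCertDataVW kitOf wT sc).S j - 1))))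
      ((TV.roInWin kitOf wT A WV j).Zl TV.base U uR Hl) := by
  set s := (TV.base.stage j).S - 1 with hs
  have hSs : (TV.toCertDataVW kitOf wT sc).S j - 1 = s := rfl
  rw [hSs] at hA hy hr ⊢
  have hu0 : 0 ≤ u := (TV.base.readoutStepWinP_win (TV.roInWinP kitOf wT A WV j) hok).1.trans hulo
  have hF := TV.base.readoutStepWin_Zl (TV.roInWin kitOf wT A WV j) hk.coef (hk.box j) (hk.mt j) (size_hullBox 2 j s) huU hu0 hulo huhi huR
    (fun i k h1 h2 => mem_ωinvB j i k h1 h2) (inStep_window hA) (Hl := Hl) (by rw [hH]; exact memVec_of_inBox_hull hy)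
    (r := r) (fun c hc => by
      have hkc := TV.base.InW_wk hc
      have h1 := hr (TV.base.wi c) (TV.base.wk c) hkc.1 hkc.2
      dsimp only at h1
      rw [bx_J, TV.base.vecF_apply, if_pos hkc, TV.base.idx_wi_wk hc] at h1
      exact h1)
  intro c hc
  rw [wv_inStep_state j s u Ak y r hc]
  exact hF c hc

/-! ### (R5), (R7) -/

/-- **(R5)** of `ReadoutsVW` at stage `j` (section at the nodes). [folklore] -/
theorem readoutWP_R5 {j : ℕ} (hok : (TV.roOutWinP kitOf wT A WV j).ok = true) :
    (∀ y, InBox (TV.toCertDataVW kitOf wT sc) ((TV.toBoxesW kitOf wT).hlo 1 j ((TV.toCertDataVW kitOf wT sc).S j - 1))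
        ((TV.toBoxesW kitOf wT).hhi 1 j ((TV.toCertDataVW kitOf wT sc).S j - 1)) y →
      (TV.toCertDataVW kitOf wT sc).σf j y < (TV.toCertDataVW kitOf wT sc).lev j) ∧
    (∀ y, InBox (TV.toCertDataVW kitOf wT sc) ((TV.toBoxesW kitOf wT).hlo 1 j ((TV.toCertDataVW kitOf wT sc).S j))
        ((TV.toBoxesW kitOf wT).hhi 1 j ((TV.toCertDataVW kitOf wT sc).S j)) y →
      (TV.toCertDataVW kitOf wT sc).lev j < (TV.toCertDataVW kitOf wT sc).σf j y) := by
  have h := TV.base.readoutStepWinP_R5 (TV.roInWinP kitOf wT A WV j) hok (mem_covB (TV.base.stage j).σf)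
    (IntervalD.mem_ofQS2 TV.prec (TV.base.stage j).lev)
  refine ⟨fun y hy => ?_, fun y hy => ?_⟩
  · rw [cd_sigma, cd_lev]; exact h.1 y (memVec_of_inBox_hull hy)
  · rw [cd_sigma, cd_lev]; exact h.2 y (memVec_of_inBox_hull hy)

/-- **(R7)** of `ReadoutsVW` at stage `j` (on the fat level-1 box). [folklore] -/
theorem readoutWP_R7 (hk : KitOK TV kitOf) {G : ℕ → ℕ → ℕ → ℝ} {ΛT : ℕ → ℝ} {j : ℕ} (hok : (TV.roOutWinP kitOf wT A WV j).ok = true) :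
    ∀ y, InBox (TV.toCertDataVW kitOf wT sc) ((TV.toReadoutDataWinP kitOf wT A WV G ΛT).ylo 1 j) ((TV.toReadoutDataWinP kitOf wT A WV G ΛT).yhi 1 j) y →
      (TV.toCertDataVW kitOf wT sc).γ j ≤ (TV.toCertDataVW kitOf wT sc).σf j ((TV.toCertDataVW kitOf wT sc).Qb y y) := by
  intro y hy
  rw [rowP_ylo1, rowP_yhi1] at hy
  rw [cd_gamma, cd_sigma, cd_Qb]
  exact TV.base.readoutStepWinP_R7 (TV.roInWinP kitOf wT A WV j) hk.coef (hk.box j) (hk.mt j) hok (mem_covB (TV.base.stage j).σf)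
    (IntervalD.mem_ofQS2 TV.prec (TV.base.stage j).γ) y (memVec_of_inBox_loR hy)

/-! ### (R8w), (R9w) on the windowed boxes -/

/-- **(R8w)** of `ReadoutsVW` at stage `j` (crossing read-outs on `Z¹`). [folklore] -/
theorem readoutWP_R8 (hA : TV.base.checkReadoutAux A = true) {j : ℕ} (hok : (TV.roOutWinP kitOf wT A WV j).ok = true) :
    ∀ y, InBox (TV.toCertDataVW kitOf wT sc) ((TV.toWinDataP kitOf wT A WV).zlo 1 j) ((TV.toWinDataP kitOf wT A WV).zhi 1 j) y →
      (TV.toCertDataVW kitOf wT sc).σf j y = (TV.toCertDataVW kitOf wT sc).lev j →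
      (TV.toCertDataVW kitOf wT sc).as j ≤ |y (TV.toCertDataVW kitOf wT sc).i₀ 1| ∧
      ∀ i, |y i (-(TV.toCertDataVW kitOf wT sc).Kb)| + (TV.toCertDataVW kitOf wT sc).Λ j * (TV.toCertDataVW kitOf wT sc).δ j *
          (TV.toCertDataVW kitOf wT sc).τs * (TV.toCertDataVW kitOf wT sc).ω j (-(TV.toCertDataVW kitOf wT sc).Kb) ≤
        (2:ℝ) ^ (-(TV.toCertDataVW kitOf wT sc).θ) *
          ((TV.toCertDataVW kitOf wT sc).Cb * (2:ℝ) ^ ((3:ℝ) / 4 * (((TV.toCertDataVW kitOf wT sc).Kb : ℝ) + 1))) := by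
  intro y hy _
  rw [rwP_zlo1, rwP_zhi1] at hy
  have h := TV.base.readoutStepWinP_R8 (TV.roInWinP kitOf wT A WV j) hok (IntervalD.mem_ofQS2 TV.prec (TV.base.stage j).as)
    (mem_AK (kitOf := kitOf) (wT := wT) (sc := sc) hA j) (rlo_le (kitOf := kitOf) (wT := wT) (sc := sc) hA) y (memVec_of_inBox_loR hy)
  rw [cd_as, cd_i0]
  refine ⟨h.1, fun i => ?_⟩
  have h2 := h.2 i
  rw [cd_Kb] at h2 ⊢
  exact h2

/-! ### (W1)–(W3): window order and window-end sections -/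

/-- **(W1)** of `ReadoutsVW` at stage `j` (window order inside the last sub-step). [folklore] -/
theorem readoutWP_W1 {j : ℕ} (hok : (TV.roOutWinP kitOf wT A WV j).ok = true) :
    0 ≤ (TV.toWinDataP kitOf wT A WV).ulo 1 j ∧ (TV.toWinDataP kitOf wT A WV).ulo 1 j ≤ (TV.toWinDataP kitOf wT A WV).ulo 0 j ∧
      (TV.toWinDataP kitOf wT A WV).ulo 0 j ≤ (TV.toWinDataP kitOf wT A WV).uhi 0 j ∧
      (TV.toWinDataP kitOf wT A WV).uhi 0 j ≤ (TV.toWinDataP kitOf wT A WV).uhi 1 j ∧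
      (TV.toWinDataP kitOf wT A WV).uhi 1 j ≤ (TV.toCertDataVW kitOf wT sc).h j ((TV.toCertDataVW kitOf wT sc).S j - 1) := by
  have h := TV.base.readoutStepWinP_win (TV.roInWinP kitOf wT A WV j) hok
  rw [rwP_ulo0, rwP_uhi0, rwP_ulo1, rwP_uhi1, cd_h]
  exact ⟨h.1, h.2.1, h.2.2.1, h.2.2.2.1, h.2.2.2.2⟩

/-- **(W2p)** of `ReadoutsVP` at stage `j`: LEVEL-1 window-end section BEFORE. [folklore] -/
theorem readoutWP_W2 (hk : KitOK TV kitOf) {j : ℕ} (hok : (TV.roOutWinP kitOf wT A WV j).ok = true) :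
    ∀ Ak : Ker, InStepKer (TV.toCertDataVW kitOf wT sc) (TV.toBoxesW kitOf wT) j ((TV.toCertDataVW kitOf wT sc).S j - 1)
        ((TV.toWinDataP kitOf wT A WV).ulo 1 j) Ak →
      ∀ y, InBox (TV.toCertDataVW kitOf wT sc) ((TV.toBoxesW kitOf wT).hlo 1 j ((TV.toCertDataVW kitOf wT sc).S j - 1))
          ((TV.toBoxesW kitOf wT).hhi 1 j ((TV.toCertDataVW kitOf wT sc).S j - 1)) y →
      ∀ r : Fin 4 → ℤ → ℝ, AbsLeW (TV.toCertDataVW kitOf wT sc) r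
          (fun i k => (TV.toBoxesW kitOf wT).J j ((TV.toCertDataVW kitOf wT sc).S j - 1) i k *
            (TV.toWinDataP kitOf wT A WV).ulo 1 j ^ ((TV.toCertDataVW kitOf wT sc).pdeg + 1)) →
        (TV.toCertDataVW kitOf wT sc).σf j ((TV.toCertDataVW kitOf wT sc).TP j ((TV.toCertDataVW kitOf wT sc).S j - 1)
            ((TV.toWinDataP kitOf wT A WV).ulo 1 j) + r +
          kapp (TV.toCertDataVW kitOf wT sc) Ak (y - (TV.toCertDataVW kitOf wT sc).x j ((TV.toCertDataVW kitOf wT sc).S j - 1))) <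
          (TV.toCertDataVW kitOf wT sc).lev j := by
  have hw := TV.base.readoutStepWinP_win (TV.roInWinP kitOf wT A WV j) hok
  intro Ak hA y hy r hr
  rw [cd_sigma, cd_lev]
  have hm := readoutWP_Zl_gen (sc := sc) hk hok (l := 1) rfl (U := ⟨(winAt WV j).u1lo, (winAt WV j).u1lo⟩) (uR := (winAt WV j).u1lo)
    ⟨le_rfl, le_rfl⟩ le_rfl (hw.2.1.trans (hw.2.2.1.trans hw.2.2.2.1)) le_rfl hA hy hr
  exact (TV.base.readoutStepWinP_R5w1 (TV.roInWinP kitOf wT A WV j) hok (mem_covB (TV.base.stage j).σf)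
    (IntervalD.mem_ofQS2 TV.prec (TV.base.stage j).lev)).1 _ hm

/-- **(W3p)** of `ReadoutsVP` at stage `j`: LEVEL-1 window-end section AFTER. [folklore] -/
theorem readoutWP_W3 (hk : KitOK TV kitOf) {j : ℕ} (hok : (TV.roOutWinP kitOf wT A WV j).ok = true) :
    ∀ Ak : Ker, InStepKer (TV.toCertDataVW kitOf wT sc) (TV.toBoxesW kitOf wT) j ((TV.toCertDataVW kitOf wT sc).S j - 1)
        ((TV.toWinDataP kitOf wT A WV).uhi 1 j) Ak →
      ∀ y, InBox (TV.toCertDataVW kitOf wT sc) ((TV.toBoxesW kitOf wT).hlo 1 j ((TV.toCertDataVW kitOf wT sc).S j - 1))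
          ((TV.toBoxesW kitOf wT).hhi 1 j ((TV.toCertDataVW kitOf wT sc).S j - 1)) y →
      ∀ r : Fin 4 → ℤ → ℝ, AbsLeW (TV.toCertDataVW kitOf wT sc) r
          (fun i k => (TV.toBoxesW kitOf wT).J j ((TV.toCertDataVW kitOf wT sc).S j - 1) i k *
            (TV.toWinDataP kitOf wT A WV).uhi 1 j ^ ((TV.toCertDataVW kitOf wT sc).pdeg + 1)) →
        (TV.toCertDataVW kitOf wT sc).lev j <
          (TV.toCertDataVW kitOf wT sc).σf j ((TV.toCertDataVW kitOf wT sc).TP j ((TV.toCertDataVW kitOf wT sc).S j - 1)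
            ((TV.toWinDataP kitOf wT A WV).uhi 1 j) + r +
          kapp (TV.toCertDataVW kitOf wT sc) Ak (y - (TV.toCertDataVW kitOf wT sc).x j ((TV.toCertDataVW kitOf wT sc).S j - 1))) := by
  have hw := TV.base.readoutStepWinP_win (TV.roInWinP kitOf wT A WV j) hok
  intro Ak hA y hy r hr
  rw [cd_sigma, cd_lev]
  have hm := readoutWP_Zl_gen (sc := sc) hk hok (l := 1) rfl (U := ⟨(winAt WV j).u1hi, (winAt WV j).u1hi⟩) (uR := (winAt WV j).u1hi)
    ⟨le_rfl, le_rfl⟩ (hw.2.1.trans (hw.2.2.1.trans hw.2.2.2.1)) le_rfl le_rfl hA hy hr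
  exact (TV.base.readoutStepWinP_R5w1 (TV.roInWinP kitOf wT A WV j) hok (mem_covB (TV.base.stage j).σf)
    (IntervalD.mem_ofQS2 TV.prec (TV.base.stage j).lev)).2 _ hm

end CertTablesV

end Summit.NavierStokesRegularity.NavierStokesRegularity.Theorems.TaylorModelCert
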